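import Summits.QuantumFields.BalabanUV.Beta.D1BFx.TwoPointBubbleSum
import Summits.QuantumFields.BalabanUV.Beta.D1BFx.CrossERecutTails

/-!
# `BalabanUV.Beta.D1BFx.GluonBubbleTails` — road «BF-x» for binder row D1, «A3.c ∕ L-X TAILS» PART II (J): the EIGHT A3.c `hLoc` CLAUSES of the END —
# the leg-graded gluon bubble words at `τ = inr (inl (0, 0, r, r'))`, `(r, r') ≠ (0, 0)`, bounded uniformly in the scale, MODULO [B5, Prop. 1.2] and
# [B5, (1.126)–(1.127)] BY NAME (`h12`∕`h126`) and the END's `hlam`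

HONEST DEPENDENCY (page 1, mandatory): continuum YM on T⁴ ⇐ BetaPertH ∧ nine spine estimates (0/9 proved); BetaPertH ⇐ (D1) ∧ (D4) ∧
CAP+tail; G-an2-4 gates asym, D1 and NE2/3/4.  HONEST FRAMING (cell contract, verbatim): «discharging `BetaPertH` makes Bałaban's UV
stability UNCONDITIONAL — a real constructive-QFT result; it is NOT the continuum limit and NOT the Clay problem.»  THIS MODULE DISCHARGES
NOTHING of the wall by itself: it proves 8 of the END's `hLoc` clauses (`RoadEndBFxRows.hGrp_of_rows`) for the road's frozen profile `gfrz`, as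
[folklore] compositions BY NAME of part (I3c) `TwoPointBubbleSum` with the rows supplied by `TwoPointLegRows.Kinf_entry_rows_of_prop12` and
`FrozenLegTails.gfrz_rows_d0_d1_of_prop12` — both CONDITIONAL on the two printed statements [B5, Prop. 1.2 (1.110)–(1.114)] (`B5.Prop12Printed`) and
[B5, (1.126)–(1.127)] (`B5.Kernel126_127Printed`) taken BY NAME exactly as the END displays them — and `FrozenLegProfile` (h0∕h1, evenness).  No `def`,
no `Prop` minted, nothing cited anew, 0 sorry.  0 wall binders discharged; NOT (K), NOT D1, NOT `BetaPertH`, NOT continuum, NOT Clay.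

ABSOLUTE RULE (cell charter, verbatim): «No internally-minted statement may enter as a cited fact. Every hypothesis is either kernel-proved in
this package or a verbatim quotation of a PUBLISHED theorem with page reference. The manuscript(s) under audit are NOT citable for their own
disputed steps — they are the thing under adjudication; programme-internal (2001/route/tribunal) claims are never citable.»

WHY (owner d1-p2-g9 `K-LOCAL-ROWS.md` v0.3, the 8 A3.c rows; RULING ρ-g9-32; this lineage's N-d1leaf03g12-2): `SplitRecut.restK'_bub` displays the word at
`τ = (0,0,r,r')` as `ω_gl·cE·cE·n⁻⁸·w_μw_ν·baseKer (biBubbleTable (legPiece r) (legPiece r') SbT SbT μ ν) b w`; `SbT κ u = realK u u (reixStn ιU (vec₀ κ ++ rem₀ κ))`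
(`CrossERecut.realK_reix_vec₀_rem₀`), so by `BiBubbleTable.biBubble_realK_realK` the table is `−½·bub₂ (legPiece r) (legPiece r') (b+w) b V_μ V_ν` with
`V_κ` graded `1`; part (I3c) bounds its weighted full sum by `A` uniformly in `n ≥ 1` and `b`; `|ω_gl cE²|·n⁻⁸ = 2N²` (`hlam`); the uniform weights `n⁻⁴` on
the residue sites sum to one.
* §1 [folklore] `reixStn_rowSh∕_colSh∕_rowDiff∕_colDiff`, **`graded_reixStn`**; `SbT_eq_realK`, `graded_SbT_list`; `row_mono` (common row constants).
* §2 [folklore] `restK'_bub_eq` (the word as `κ·w_μw_ν·bub₂`), **`hLoc_bub_of_prop12`**: for every `(r, r') ≠ (0, 0)`,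
  `∃ C ≥ 0, ∀ n ≥ 2, |Σ_{b ∈ image resSite} n⁻⁴·fullSum (w ↦ restK' n a (gfrz n a b) … (n⁸) N μ ν b (inr (inl (0,0,r,r'))) w)| ≤ C` — the 8 A3.c rows.
Unit `b2b-balaban-beta-d1-formalise-leaf-03` (gen 12), D1 formalisation swarm; `LEAVES-BFx.md` row «A3.c ∕ L-X TAILS» PART II (J).
-/

noncomputable section

namespace Summit.QuantumFields.BalabanUV.Beta.D1BFx.GluonBubbleTails

open Finset Filter Topology
open scoped BigOperators
open Literature.MathematicalPhysics.QuantumFieldTheory.Balaban1983to89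
open Literature.MathematicalPhysics.QuantumFieldTheory.Balaban1983to89.Beta
open ExpKernelCalculus (Site MKer)
open DyadicShell (Pt toReal supNorm)
open BubbleTransfer (unitVec)
open GhostTable (gFree)
open MomentTransferPeriodic (baseKer)
open WindowIdentification (psum fullSum fullSum_const_mul)
open DressedMomentNormalisation (resSite)
open GradedBubbles (LP Stn rowSh colSh smulS rowDiff colDiff Graded IsStep)
open LongitudinalWindow (ellD0 ellD1)
open WoodburyCovariant (woodburyDc woodburyD1c)
open VectorPropagatorLimit (Kinf)
open Summit.QuantumFields.BalabanUV.Beta.D1BFx.GluonKernelSectors (SbE)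
open Summit.QuantumFields.BalabanUV.Beta.D1BFx.StencilRealisation (realK)
open Summit.QuantumFields.BalabanUV.Beta.D1BFx.WilsonStencilRealised (reixStn ιU reixStn_nil reixStn_cons)
open Summit.QuantumFields.BalabanUV.Beta.D1BFx.ColourlessAntisymmetry (reixStn_append reixStn_smulS)
open Summit.QuantumFields.BalabanUV.Beta.D1BFx.FineHessianSectors (biBubbleTable biBubbleTable_apply)
open Summit.QuantumFields.BalabanUV.Beta.D1BFx.FineHessianLegGrades (legPiece)
open Summit.QuantumFields.BalabanUV.Beta.D1BFx.CrossERestLists (vec₀ rem₀ graded_vec₀ graded_rem₀)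
open Summit.QuantumFields.BalabanUV.Beta.D1BFx.CrossERecut (realK_reix_vec₀_rem₀ weight_eq_of_hlam)
open Summit.QuantumFields.BalabanUV.Beta.D1BFx.Assembly (sum_uniform_resSite uniform_resSite_nonneg)
open Summit.QuantumFields.BalabanUV.Beta.D1BFx.ContactCount (abs_sum_mul_le_of_convex)
open Summit.QuantumFields.BalabanUV.Beta.D1BFx.ReducedKernel (TableR)
open Summit.QuantumFields.BalabanUV.Beta.D1BFx.SectorRecut (divK SbT SbT_apply secSt'_zero secWt'_zero)
open Summit.QuantumFields.BalabanUV.Beta.D1BFx.SplitRecut (restK' restK'_bub)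
open Summit.QuantumFields.BalabanUV.Beta.D1BFx.BiBubbleTable (bub₂ biBubble_realK_realK)
open Summit.QuantumFields.BalabanUV.Beta.D1BFx.FrozenLegProfile (gfrz gfrz_neg abs_gfrz_sub_gFree_le abs_gfrz_diff_flat_le)
open Summit.QuantumFields.BalabanUV.Beta.D1BFx.FrozenLegTails (nOf MOf hn1 gfrz_rows_d0_d1_of_prop12)
open Summit.QuantumFields.BalabanUV.Beta.D1BFx.TwoPointLegRows (Kinf_entry_rows_of_prop12)
open Summit.QuantumFields.BalabanUV.Beta.D1BFx.TwoPointBubbleSum (exists_bound_fullSum_moment_bub₂)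
open VectorTailsLoc (fam kfam)

/-! ## §1 Re-indexed stencils keep their grading; the sector stencil as one graded list; common row constants -/

section Lists

variable {I J : Type*} (f : J → I)

/-- [folklore] `reixStn` commutes with row translation. -/
theorem reixStn_rowSh (e : Pt) (V : Stn I) : reixStn f (rowSh e V) = rowSh e (reixStn f V) := by
  induction V with
  | nil => rfl
  | cons p V ih =>
      have e1 : rowSh e (p :: V) = ⟨p.x + e, p.y, p.m⟩ :: rowSh e V := rfl
      have e2 : rowSh e (reixStn f (p :: V)) = ⟨p.x + e, p.y, p.m.submatrix f f⟩ :: rowSh e (reixStn f V) := rfl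
      rw [e1, reixStn_cons, e2, ih]

/-- [folklore] `reixStn` commutes with column translation. -/
theorem reixStn_colSh (e : Pt) (V : Stn I) : reixStn f (colSh e V) = colSh e (reixStn f V) := by
  induction V with
  | nil => rfl
  | cons p V ih =>
      have e1 : colSh e (p :: V) = ⟨p.x, p.y + e, p.m⟩ :: colSh e V := rfl
      have e2 : colSh e (reixStn f (p :: V)) = ⟨p.x, p.y + e, p.m.submatrix f f⟩ :: colSh e (reixStn f V) := rfl
      rw [e1, reixStn_cons, e2, ih]

/-- [folklore] `reixStn` commutes with row differences. -/
theorem reixStn_rowDiff (e : Pt) (V : Stn I) : reixStn f (rowDiff e V) = rowDiff e (reixStn f V) := by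
  rw [rowDiff, rowDiff, reixStn_append, reixStn_rowSh, reixStn_smulS]

/-- [folklore] `reixStn` commutes with column differences. -/
theorem reixStn_colDiff (e : Pt) (V : Stn I) : reixStn f (colDiff e V) = colDiff e (reixStn f V) := by
  rw [colDiff, colDiff, reixStn_append, reixStn_colSh, reixStn_smulS]

/-- [folklore] **RE-INDEXED STENCILS KEEP THEIR GRADING.** -/
theorem graded_reixStn {m : ℕ} {V : Stn I} (hV : Graded m V) : Graded m (reixStn f V) := by
  induction hV with
  | zero V => exact Graded.zero _
  | weaken _ ih => exact ih.weaken
  | rowDiff he _ ih => rw [reixStn_rowDiff]; exact Graded.rowDiff he ih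
  | colDiff he _ ih => rw [reixStn_colDiff]; exact Graded.colDiff he ih
  | rowSh e _ ih => rw [reixStn_rowSh]; exact Graded.rowSh e ih
  | colSh e _ ih => rw [reixStn_colSh]; exact Graded.colSh e ih
  | append _ _ ih ih' => rw [reixStn_append]; exact ih.append ih'
  | smul c _ ih => rw [reixStn_smulS]; exact Graded.smul c ih

end Lists

/-- [folklore] **THE TRANSVERSE-COMPLETED E-STENCIL AS ONE REALISED LIST**: `SbT κ u = realK u u (reixStn ιU (vec₀ κ ++ rem₀ κ))`. -/
theorem SbT_eq_realK (κ : Fin 4) (u : Pt) : SbT κ u = realK u u (reixStn ιU (vec₀ κ ++ rem₀ κ)) := by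
  rw [SbT_apply]
  exact realK_reix_vec₀_rem₀ κ u

/-- [folklore] … and that list has grading `1` (`vec₀`: 1, `rem₀`: 2). -/
theorem graded_SbT_list (κ : Fin 4) : Graded 1 (reixStn ιU (vec₀ κ ++ rem₀ κ)) :=
  graded_reixStn ιU ((graded_vec₀ κ).append (graded_rem₀ κ).weaken)

/-- [folklore] **COMMON ROW CONSTANTS**: a soft row with `(δ', A')` implies the row with any `δ ≤ δ'` and `A ≥ A'`. -/
theorem row_mono {n : ℕ} {δ δ' A A' X : ℝ} {s : ℕ} {p : ℕ} (hδ : δ ≤ δ') (hA : A' ≤ A) (hA' : 0 ≤ A')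
    (h : X ≤ A' * Real.exp (-(δ' / n) * (s : ℝ)) / (s : ℝ) ^ p) : X ≤ A * Real.exp (-(δ / n) * (s : ℝ)) / (s : ℝ) ^ p := by
  refine h.trans ?_
  have hn : (0 : ℝ) ≤ n := Nat.cast_nonneg _
  have hs : (0 : ℝ) ≤ s := Nat.cast_nonneg _
  have hexp : Real.exp (-(δ' / n) * (s : ℝ)) ≤ Real.exp (-(δ / n) * (s : ℝ)) := by
    refine Real.exp_le_exp.mpr ?_
    have : δ / n * s ≤ δ' / n * s := mul_le_mul_of_nonneg_right (div_le_div_of_nonneg_right hδ hn) hs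
    linarith
  have hA0 : 0 ≤ A := hA'.trans hA
  gcongr

/-! ## §2 The word as a weighted two-leg table; the eight `hLoc` clauses -/

section Word

variable (n : ℕ) [NeZero n] (a : ℝ) (g : Pt → ℝ) (cE cΛ cR cK cQ cE₂ cJ4 cΛ₂ cR₂ cQ₂ x₀ : ℝ) (WE WJ WΛ WR WQ : TableR)
  (ωgl ωgh lam N : ℝ) (μ ν : Fin 4) (b : Pt)

/-- [folklore] **THE LEG-GRADED BUBBLE WORD AS A WEIGHTED TWO-LEG TABLE**: at `τ = inr (inl (0, 0, r, r'))`, `(r, r') ≠ (0, 0)`,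
`restK' … b τ w = (ω_gl·(cE·cE)·n⁻⁸·(−½)) · (w_μ w_ν · bub₂ (legPiece r) (legPiece r') (b + w) b V_μ V_ν)`. -/
theorem restK'_bub_eq {r r' : Fin 3} (hrr : ¬(r = 0 ∧ r' = 0)) :
    (fun w : Pt => restK' n a g cE cΛ cR cK cQ cE₂ cJ4 cΛ₂ cR₂ cQ₂ x₀ WE WJ WΛ WR WQ ωgl ωgh lam N μ ν b (Sum.inr (Sum.inl (0, 0, r, r'))) w) =
      fun w : Pt => (ωgl * (cE * cE) * ((n : ℝ) ^ 8)⁻¹ * (-(1 / 2 : ℝ))) * (toReal w μ * toReal w ν *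
        bub₂ (legPiece n a g r) (legPiece n a g r') (b + w) b (reixStn ιU (vec₀ μ ++ rem₀ μ)) (reixStn ιU (vec₀ ν ++ rem₀ ν))) := by
  funext w
  rw [restK'_bub]
  have hne : ((0 : Fin 3), (0 : Fin 3), r, r') ≠ ((0 : Fin 3), (0 : Fin 3), (0 : Fin 3), (0 : Fin 3)) := by
    intro h
    simp only [Prod.mk.injEq, true_and] at h
    exact hrr h
  rw [if_neg hne]
  dsimp only
  rw [secWt'_zero, secSt'_zero, baseKer, biBubbleTable_apply, SbT_eq_realK, SbT_eq_realK, biBubble_realK_realK]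
  ring

end Word

section End

variable {a : ℝ} {cE cΛ cR cK cQ cE₂ cJ4 cΛ₂ cR₂ cQ₂ x₀ ωgl ωgh : ℕ → ℝ} {WE WJ WΛ WR WQ : ℕ → TableR} {N : ℝ} {μ ν : Fin 4}

/-- [folklore] **THE EIGHT A3.c `hLoc` CLAUSES OF `RoadEndBFxRows.hGrp_of_rows`** (`τ = inr (inl (0, 0, r, r'))`, `(r, r') ≠ (0, 0)`: the leg-graded
gluon bubble words over the transverse-completed E-sector) FOR THE ROAD'S FROZEN PROFILE `gfrz`, MODULO [B5, Prop. 1.2 (1.110)–(1.114)] AND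
[B5, (1.126)–(1.127)] BY NAME (`h12`∕`h126`, exactly as the END displays them) AND THE END's `hlam`:
`∃ C ≥ 0, ∀ n ≥ 2, |Σ_{b ∈ image resSite} n⁻⁴·fullSum (w ↦ restK' n a (gfrz n a b) … (n⁸) N μ ν b τ w)| ≤ C`.
DEPENDENCE: `C = N²·A(a, δ, A₀, A₁, D₀, D₁; r, r')` with `(δ, A₀, A₁)` the common constants of the entry rows of `K^∞` and the rows of `gfrz`,
`D₀ = woodburyDc 0 + ellD0 4 a`, `D₁ = woodburyD1c 0 + ellD1 4 a`; no `n`, no `b`, no `μ, ν`; NO scalar letter beyond `hlam`; NO `h2s`∕`d2s`; NO `DG 3 2`. -/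
theorem hLoc_bub_of_prop12 (ha : 0 < a) (h12 : B5.Prop12Printed (fam nOf hn1 MOf a ha)) (h126 : B5.Kernel126_127Printed (kfam nOf MOf))
    (hlam : ∀ n : ℕ, 2 ≤ n → ωgl n * cE n ^ 2 = 2 * N ^ 2 * (n : ℝ) ^ 8) (r r' : Fin 3) (hrr : ¬(r = 0 ∧ r' = 0)) :
    ∃ C : ℝ, 0 ≤ C ∧ ∀ n : ℕ, 2 ≤ n → ∀ [NeZero n],
      |∑ b ∈ (univ : Finset (Fin 4 → Fin n)).image resSite, ((n : ℝ) ^ 4)⁻¹ *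
        fullSum (fun w : Pt => restK' n a (gfrz n a b) (cE n) (cΛ n) (cR n) (cK n) (cQ n) (cE₂ n) (cJ4 n) (cΛ₂ n) (cR₂ n) (cQ₂ n) (x₀ n)
          (WE n) (WJ n) (WΛ n) (WR n) (WQ n) (ωgl n) (ωgh n) ((n : ℝ) ^ 8) N μ ν b (Sum.inr (Sum.inl (0, 0, r, r'))) w)| ≤ C := by
  -- the rows, with common constants
  obtain ⟨δ₁, B₀, B₁, hδ₁, hB₀, hB₁, hK⟩ := Kinf_entry_rows_of_prop12 a ha h12 h126
  obtain ⟨δ₂, G₀', G₁', hδ₂, hG₀, hG₁, d0, d1⟩ := gfrz_rows_d0_d1_of_prop12 ha h12 h126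
  have hD₀ : 0 ≤ woodburyDc 0 + ellD0 4 a := add_nonneg VectorLegVolumeAdapter.woodburyDc_zero_nonneg (OffDiagonalLegGrade.ellD0_nonneg ha)
  have hD₁ : 0 ≤ woodburyD1c 0 + ellD1 4 a := add_nonneg VectorLegVolumeAdapter.woodburyD1c_zero_nonneg (OffDiagonalLegGrade.ellD1_nonneg ha)
  have hδ : 0 < min δ₁ δ₂ := lt_min hδ₁ hδ₂
  obtain ⟨A, hA, h⟩ := exists_bound_fullSum_moment_bub₂ (graded_SbT_list μ) (graded_SbT_list ν) le_rfl (by norm_num) r r' hrr ha hδ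
    (le_max_of_le_left hB₀ : (0 : ℝ) ≤ max B₀ G₀') (le_max_of_le_left hB₁ : (0 : ℝ) ≤ max B₁ G₁') hD₀ hD₁
  refine ⟨2 * N ^ 2 * ((1 / 2 : ℝ) * A), by positivity, fun n hn _ => ?_⟩
  have hn1 : 1 ≤ n := le_trans one_le_two hn
  have hw : |ωgl n * (cE n * cE n)| * ((n : ℝ) ^ 8)⁻¹ = 2 * N ^ 2 := weight_eq_of_hlam (by omega) (hlam n hn)
  refine abs_sum_mul_le_of_convex _ (fun b hb => uniform_resSite_nonneg n b hb) (sum_uniform_resSite (NeZero.ne n)) fun b _ => ?_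
  -- the rows at scale `n`, base point `b`
  have e0 : ∀ (x w : Pt) (κ l : Fin 4), w ≠ 0 → |Kinf n a (x, κ) (x + w, l)| ≤ max B₀ G₀' * Real.exp (-(min δ₁ δ₂ / n) * supNorm w) / (supNorm w : ℝ) ^ 2 :=
    fun x w κ l hw0 => row_mono (min_le_left _ _) (le_max_left _ _) hB₀ (hK n x w κ l hw0).1
  have e1 : ∀ (x w : Pt) (κ l : Fin 4), w ≠ 0 → ∀ ρ : Fin 4, |Kinf n a (x, κ) (x + w + unitVec ρ, l) - Kinf n a (x, κ) (x + w, l)| ≤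
      max B₁ G₁' * Real.exp (-(min δ₁ δ₂ / n) * supNorm w) / (supNorm w : ℝ) ^ 3 :=
    fun x w κ l hw0 ρ => row_mono (min_le_left _ _) (le_max_left _ _) hB₁ ((hK n x w κ l hw0).2 ρ)
  have g0 : ∀ v : Pt, v ≠ 0 → |gfrz n a b v| ≤ max B₀ G₀' * Real.exp (-(min δ₁ δ₂ / n) * supNorm v) / (supNorm v : ℝ) ^ 2 :=
    fun v hv => row_mono (min_le_right _ _) (le_max_right _ _) hG₀ (d0 n b v hv)
  have g1 : ∀ v : Pt, v ≠ 0 → ∀ ρ : Fin 4, |gfrz n a b (v + unitVec ρ) - gfrz n a b v| ≤ max B₁ G₁' * Real.exp (-(min δ₁ δ₂ / n) * supNorm v) / (supNorm v : ℝ) ^ 3 :=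
    fun v hv ρ => row_mono (min_le_right _ _) (le_max_right _ _) hG₁ (d1 n b v hv ρ)
  obtain ⟨⟨L, hL⟩, hb'⟩ := h n hn1 (gfrz n a b) (fun w => gfrz_neg w) e0 e1 g0 g1 (fun v => abs_gfrz_sub_gFree_le n hn1 ha b v)
    (fun v ρ => abs_gfrz_diff_flat_le n hn1 ha b v ρ) b μ ν
  rw [restK'_bub_eq n a (gfrz n a b) (cE n) (cΛ n) (cR n) (cK n) (cQ n) (cE₂ n) (cJ4 n) (cΛ₂ n) (cR₂ n) (cQ₂ n) (x₀ n) (WE n) (WJ n) (WΛ n) (WR n) (WQ n)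
    (ωgl n) (ωgh n) ((n : ℝ) ^ 8) N μ ν b hrr, fullSum_const_mul _ ⟨L, hL⟩, abs_mul, ← hw]
  have hκ : |ωgl n * (cE n * cE n) * ((n : ℝ) ^ 8)⁻¹ * (-(1 / 2 : ℝ))| = |ωgl n * (cE n * cE n)| * ((n : ℝ) ^ 8)⁻¹ * (1 / 2 : ℝ) := by
    rw [abs_mul, abs_mul, abs_of_nonneg (by positivity : (0 : ℝ) ≤ ((n : ℝ) ^ 8)⁻¹), show |(-(1 / 2 : ℝ))| = 1 / 2 by norm_num]
  rw [hκ, mul_assoc]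
  exact mul_le_mul_of_nonneg_left (mul_le_mul_of_nonneg_left hb' (by norm_num)) (by positivity)

end End

end Summit.QuantumFields.BalabanUV.Beta.D1BFx.GluonBubbleTails

end
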